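import Summits.QuantumFields.YangMills.Theorems.UnitScaleTiltProp7CombFlatCoerciveAtSlotOfRecord
import Summits.QuantumFields.YangMills.Theorems.UnitScaleTiltProp7SliceRowOfFilling
import Summits.QuantumFields.YangMills.Theorems.UnitScaleTiltProp7SliceRowOfSqBound
import Summits.QuantumFields.YangMills.Theorems.UnitScaleTiltProp7CoerciveOfInverseBound
import HarnessLib

/-!
# `UnitScaleTiltProp7A6cCertificateOfSliceRow` — THE A6ᶜ CERTIFICATE DOOR: the DISPLAYED (N06)ᶜ row `hN06` of S27ᴸ IS INHABITED AT THE FLAT MEMBER `W := 1` — in the `∃ G₀`∕norm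
# form the display carries, for every `K`, `n < K`, `L` — from ONE displayed row, the slice bound (I3′) (§1), resp. from a FILLING CERTIFICATE `(S, A, M)` of the translated defect alone (§3)
(route `UnitScaleTilt`, crux K1 «MinimiserStabilityRegPr» stmt-QuantumFields-19200; ★★OWNER RULING g28-№13 (c2)(c3) «A6 BY KERNEL at `U₀ = 1`», RULING №17 (2)–(3) «COMB-FLAT COERCIVITY … closing
certificate A6ᶜ», RULING №18 (2) «COMB-FLAT-COERCIVITY := FILE B ∘ τ + isometry transfer + (I3′) δQ-SLICE», ★★OWNER 2026-08-29T05:14:30Z «px6 … the A6ᶜ certificate … when COMB-FLAT closes by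
`exact`» — this file is that certificate typed ONE DOOR EARLY: (I3′) displayed as the hypothesis (hv) ∕ as a filling certificate, so the close IS one `exact`; def-free, count-neutral; zero-twin
split with w1 g14 ✓`Prop7QprimeCombL2.coercive_laplaceAK_RcombL2_one_of_sliceBound` — the COERCIVE form at the slot is w1's and is IMPORTED, the `∃ G₀` display form, the family form and
the filling form are this file's).  Cell `ym3-torus` (HUMAN RULING D-0037, YM ladder rung R3 — YM₃ on T³ is a rung, not d = 4, not infinite volume, not a mass gap, not Clay), width seat
`ym3-torus-px6` (gen 6).

THE PRINT.  [Balaban1985BackgroundPropagators] (3.26)–(3.27) p. 395: `Δ_a(U) = Δ^η(U) + D R(U) D* + Q*(U) a Q(U)`, `G(U) = Δ_a(U)⁻¹`; Thm 3.3 p. 399 ∕ Thm 3.11 p. 416: `G(U)` exists with L²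
bounds «dependent on d and L only» for `U` in the regularity class — the DISPLAYED row `hN06` of the EX display (S27ᴸ ✓`Prop7StubEXOfChartPiecesTwS27L.stubEX_of_chartPiecesTwS27L` :265–272) reads,
per odd `L > 1`: `∃ B₀ eN > 0, ∀ F (F.L = L) n K (n < K) e W, 0 < e ≤ eN → RegPr F n K e W → ∃ G₀, Δ_aᶜ(W) ∘ G₀ = id ∧ ∀ f, ‖G₀ f‖ ≤ B₀‖f‖` at the COMB SLOTS OF RECORD
`Δ_aᶜ(W) := laplaceAK (DeltaEtaSlot W) (DL2 W) (RcombL2 W) (DstarL2 W) (Qkc W) (Qkc W)† ↑(a₀(c₀∕cB)ℓ³)`.  [Balaban1985RegularSpaces] p. 98: «the configuration identically equal to 1 satisfies,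
of course, all possible regularity conditions» — lit ✓`regPr_one`: the member `W = 1` lies in EVERY `RegPr F n K e`, so a certificate at `W = 1` inhabits the row's hypothesis range and its
conclusion TOGETHER (RULING g28-№13 (c3): the test that the displayed letter is neither vacuous nor K-dependent at the flat member).

WHAT IS PROVED (sorry-free, no definition; member `F`, `n < K`, weights `c₀ cB > 0`, comb-penalty weight `a₀ > 0`, `x₀ := basePt F n K`, `ℓ := L^{K−n}`):
* §1 ★★★ `hN06_at_one_of_sliceRow` — THE A6ᶜ CERTIFICATE (member level) FROM THE SLICE ROW: under the slice bound (hv) of ✓`Prop7CombFlatProjectorTransport.coercive_laplaceAc_one_of_sliceBound_basePt`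
  (px13 g6 ✓p698599; VERBATIM at the slot `DeltaEtaSlot`), `∃ G₀, Δ_aᶜ(1) ∘ G₀ = id ∧ ∀ f, ‖G₀ f‖ ≤ 4·Cst 3 a₀·(2+2ρ)·‖f‖` — `hN06`'s displayed CONCLUSION at `W := 1` TOKEN FOR TOKEN
  (`B₀ := 4·Cst 3 a₀·(2+2ρ)`): w1 g14's coercive form ✓`coercive_laplaceAK_RcombL2_one_of_sliceBound` (= px13's theorem transported to the displayed slot by ✓`RcombL2_one_eq_Rc_one` and
  px6 g5's `rfl` ✓`laplaceAc_eq_laplaceAK`) ∘ w4 g8's ✓`Prop7CoerciveOfInverseBound.exists_inverse_of_coercive` (coercive ⟹ bounded two-sided inverse, finite dimension; the same device as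
  ★p1 g18's ✓`Prop7NormG0OfCoercive.exists_rightInverse_of_coercive`, whose `hN06_of_coerciveRow` is the curved-`W` socket adapter this certificate instantiates at `1`);
  `regPr_one_mem` — `W = 1 ∈ RegPr F n K e` for every `e > 0`.
* §2 ★★ `hN06_prefix_at_one_of_sliceRows` — THE FAMILY FORM: if (hv) holds for every member of `T3Family` at `F.L = L` with an L-only `ρ L ≥ 0`, then for every `L > 1` there is an
  L-only `B₀ > 0` with `hN06`'s conclusion at `W := 1` for ALL `F (F.L = L)`, `n < K` — `∀ K` INSIDE (RULING g28-№13 (c2)).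
* §3 ★★★ `hN06_at_one_of_filling` — THE A6ᶜ CERTIFICATE FROM A FILLING CERTIFICATE ALONE: for every real plaquette family `S : PBond (F.P n) 0 → Plaq (F.P K) 0 → ℝ` representing the
  translated comb∕tube defect `toL2B⁻¹(Q_kᶜ(1)(toL2 (X ∘ translate(−x₀))) − Q_k(1)(toL2 X))(c) = Σ_p S_c(p) • curl 1 X p` with `Σ_p S_c(p)² ≤ A` and `#{c : S_c(p) ≠ 0} ≤ M`
  (w4 g8's FILE B ✓`Prop7SliceRowOfFilling` §5 `coercive_laplaceAc_one_of_filling`): `∃ G₀, Δ_aᶜ(1) ∘ G₀ = id ∧ ∀ f, ‖G₀ f‖ ≤ 4·Cst 3 a₀·(2 + 2·(a₀·(A·M)·ℓ))·‖f‖` at the displayed slot —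
  so A6ᶜ is K-UNIFORM iff `A·M·ℓ ≤ C_L` (w4 g8 LOCATE v2 d592d91c: `A ≤ 8.3∕ℓ`, `M ≤ 375`, L-free); and its family form ★★ `hN06_prefix_at_one_of_fillings`.
* §4 (v2.1, APPEND) ★★★ `hN06_at_one_of_sqBound` ∕ ★★ `hN06_prefix_at_one_of_sqBounds` — the same certificate from the DIRECT `ℓ²` slice bound `hT` of w4 g8's FILE B′ ✓`Prop7SliceRowOfSqBound`
  (PLAN B P4's output; `B₀ = 4·Cst 3 a₀·(2 + 2·a₀·A′·ℓ)`).
HONEST FRAMING.  Bookkeeping over five landed files (w1's slot transport, px13 ✓p698599, w4 ✓p688615∕FILE B, px6 ✓p692354; ★p1 ✓p699006 is the curved-`W` adapter of the same rows); NO estimate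
is proved here: the analytic content of A6ᶜ is the filling `(S, A, M)` of (I3′) — pen ★w4 g8 (F-c-1 ✓, F-c-2 (ii)∕(iii-a) signed, (i)∕(iii-b)∕(iv) open) — and once it lands, §3 closes A6ᶜ by
ONE `exact`.  CAVEATS OF RECORD carried verbatim: RULING №17 — the CLASS-LEVEL flat certificate is the S-letters one (✓`Prop7LaplaceAFlatCoercive.coercive_laplaceA_one` ∘
✓`Prop7FlatCoercivityR.flat_coercive_R_T3`), the comb member differs from it by the located pure-gauge term `QTw 1 − QTwS 1 = −∂_k∘σ`; RULING №18 — the comb and S flat gauge classes are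
identified only after the half-block lattice translation `τ = t_{x₀}` (`N_c(1) = τ·N_S(1)`, `Rc 1 = τ RS 1 τ⁻¹`, `Qkc 1 = τ Qk 1 τ⁻¹ + δQ`), which lives INSIDE the proofs (✓p697974∕✓p698599∕w4 §5),
never as a displayed letter.  Nothing of `hN06` at curved `W` (N06 = [B9] Thm 3.3∕3.11 proper, XL), of HESS ∕ E′ ∕ EX ∕ the crux K1 is proved or claimed; rung R3, not Clay; YM gap NOT proved.
`--supports stmt-QuantumFields-19200 --as helper`.
References: T. Bałaban, CMP 99 (1985) 389–434 [Balaban1985BackgroundPropagators] ((3.26)–(3.27) p.395, Thm 3.3 p.399, Thm 3.11 p.416, (3.21) p.394); CMP 95 (1984) 17–40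
[Balaban1984PropagatorsI] (Prop. 1.1 (1.90) p.33); CMP 102 (1985) 277–309 [Balaban1985Variational] ((6) p.278, (141)–(142) p.299); CMP 98 (1985) 17–51 [Balaban1985RegularSpaces] (p.98).
-/

noncomputable section

open scoped InnerProductSpace ComplexConjugate Matrix.Norms.L2Operator BigOperators

namespace Summit.QuantumFields.YangMills.Theorems.Prop7A6cCertificateOfSliceRow

open Literature.MathematicalPhysics.QuantumFieldTheory.Balaban1983to89
open Literature.MathematicalPhysics.QuantumFieldTheory.Balaban1983to89.T3ContinuumYM3Torus
open Literature.MathematicalPhysics.QuantumFieldTheory.Balaban1983to89.T3PrintedRegularMinimiser (RegPr regPr_one)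
open LatticeFieldCalculus (curl)
open B11Eq103H1Complex (SiteL2K BondL2K laplaceAK)
open Summit.QuantumFields.YangMills.Theorems.Prop7SectET3Transport (periodsT3)
open Summit.QuantumFields.YangMills.Theorems.Prop7SectET3HilbertLetters (W₂ toL2 toL2B DL2 DstarL2)
open Summit.QuantumFields.YangMills.Theorems.Prop7SectET3GaugeProjector (RS)
open Summit.QuantumFields.YangMills.Theorems.Prop7SectET3WilsonHessian (DeltaEta DeltaEtaSlot)
open Summit.QuantumFields.YangMills.Theorems.Prop7SectET3CurvedPropagators (Qk)
open Summit.QuantumFields.YangMills.Theorems.Prop7SectET3CombLetters (Rc Qkc laplaceAc laplaceAc_eq_laplaceAK)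
open Summit.QuantumFields.YangMills.Theorems.Prop7QprimeCombL2 (RcombL2 RcombL2_one_eq_Rc_one coercive_laplaceAK_RcombL2_one_of_sliceBound)
open Summit.QuantumFields.YangMills.Theorems.Prop7SPrint (basePt)
open Summit.QuantumFields.YangMills.Theorems.Prop7SliceRowOfFilling (coercive_laplaceAc_one_of_filling)
open Summit.QuantumFields.YangMills.Theorems.Prop7SliceRowOfSqBound (coercive_laplaceAc_one_of_sqBound)
open Summit.QuantumFields.YangMills.Theorems.Prop7CoerciveOfInverseBound (exists_inverse_of_coercive)

/-! ## §1 ★★★ The A6ᶜ certificate at the member: `hN06`'s conclusion at `W := 1` from the slice row (I3′) -/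

section Member

variable {F : T3Family} {n K : ℕ} {c₀ cB : ℝ} [Fact (0 < c₀)] [Fact (0 < cB)]

/-- ★★★ **THE A6ᶜ CERTIFICATE (member level) — `hN06`'s DISPLAYED CONCLUSION AT `W := 1` FROM THE SLICE BOUND (I3′):** for `a₀ > 0`, `ρ ≥ 0` and the slice row (hv) of
✓`coercive_laplaceAc_one_of_sliceBound_basePt` at the slot `DeltaEtaSlot`,
`∃ G₀, laplaceAK (DeltaEtaSlot 1) (DL2 1) (RcombL2 1) (DstarL2 1) (Qkc 1) (Qkc 1)† ↑(a₀(c₀∕cB)ℓ³) ∘ₗ G₀ = id ∧ ∀ f, ‖G₀ f‖ ≤ 4·Cst 3 a₀·(2+2ρ)·‖f‖` — TOKEN FOR TOKEN the conclusion of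
S27ᴸ's `hN06` at the member `1`, `B₀ := 4·Cst 3 a₀·(2+2ρ)` (L-only iff `ρ` is).  w1 g14's ✓`coercive_laplaceAK_RcombL2_one_of_sliceBound` ∘ ✓`exists_inverse_of_coercive` (the `G₀` produced is even
a two-sided inverse).  [cite: Balaban1985BackgroundPropagators, Thm 3.3 p.399, Thm 3.11 p.416, (3.27) p.395; Balaban1984PropagatorsI, Prop. 1.1 (1.90) p.33] -/
theorem hN06_at_one_of_sliceRow (hnK : n < K) {a₀ : ℝ} (ha₀ : 0 < a₀) {ρ : ℝ} (hρ : 0 ≤ ρ)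
    (hv : ∀ X : PBond (F.P K) 0 → Matrix (Fin 2) (Fin 2) ℂ,
      (a₀ * (c₀ / cB) * ((F.L : ℝ) ^ (K - n)) ^ 3)
          * ‖Qkc F n K hnK.le c₀ cB (1 : GaugeField (F.P K) 0 (Matrix.specialUnitaryGroup (Fin 2) ℂ)) (toL2 F K c₀ (fun b => X (b.translate (-basePt F n K))))
              - Qk F n K hnK.le c₀ cB (1 : GaugeField (F.P K) 0 (Matrix.specialUnitaryGroup (Fin 2) ℂ)) (toL2 F K c₀ X)‖ ^ 2
        ≤ ρ * (RCLike.re ⟪toL2 F K c₀ X, DeltaEtaSlot F n K c₀ 1 (toL2 F K c₀ X)⟫_ℂ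
              + ‖RS F n K hnK.le c₀ cB (1 : GaugeField (F.P K) 0 (Matrix.specialUnitaryGroup (Fin 2) ℂ))
                  (DstarL2 F n K c₀ (1 : GaugeField (F.P K) 0 (Matrix.specialUnitaryGroup (Fin 2) ℂ)) (toL2 F K c₀ X))‖ ^ 2)) :
    ∃ G₀ : BondL2K ℂ 3 (periodsT3 F K) c₀ W₂ →ₗ[ℂ] BondL2K ℂ 3 (periodsT3 F K) c₀ W₂,
      laplaceAK (DeltaEtaSlot F n K c₀ 1) (DL2 F n K c₀ 1) (RcombL2 F n K c₀ 1) (DstarL2 F n K c₀ 1)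
          (Qkc F n K hnK.le c₀ cB 1) (LinearMap.adjoint (Qkc F n K hnK.le c₀ cB 1))
          (((a₀ * (c₀ / cB) * ((F.L : ℝ) ^ (K - n)) ^ 3 : ℝ) : ℂ)) ∘ₗ G₀ = LinearMap.id ∧
      ∀ f, ‖G₀ f‖ ≤ 4 * B5Prop11Plancherel.Cst 3 a₀ * (2 + 2 * ρ) * ‖f‖ := by
  have hC : 0 < B5Prop11Plancherel.Cst 3 a₀ := B5Prop11Lattice.Cst_pos (d := 3) (a := a₀)
  have hγ : 0 < 1 / (4 * B5Prop11Plancherel.Cst 3 a₀ * (2 + 2 * ρ)) := by positivity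
  obtain ⟨G₀, hG, -, hB⟩ := exists_inverse_of_coercive _ hγ (coercive_laplaceAK_RcombL2_one_of_sliceBound hnK.le (cB := cB) ha₀ hρ hv)
  refine ⟨G₀, hG, fun f => ?_⟩
  have h := hB f
  rwa [one_div, inv_inv] at h

/-- **THE MEMBER `W = 1` LIES IN EVERY REGULARITY CLASS `RegPr F n K e`, `e > 0`** (lit ✓`regPr_one`): the displayed prefix `0 < e → e ≤ eN → RegPr F n K e W →` of `hN06` is met at the
member where §1∕§3 certify the conclusion, so hypothesis range and conclusion are inhabited TOGETHER (RULING g28-№13 (c3)).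
[cite: Balaban1985RegularSpaces, p.98; Balaban1985Variational, (6) p.278] -/
theorem regPr_one_mem (F : T3Family) (n K : ℕ) {e : ℝ} (he : 0 < e) :
    RegPr F n K e (1 : GaugeField (F.P K) 0 (Matrix.specialUnitaryGroup (Fin 2) ℂ)) :=
  regPr_one he

end Member

/-! ## §2 The family form: L-only `B₀`, `∀ K` inside -/

section Family

variable (c₀ cB a₀ : ℕ → ℝ) [hc₀ : ∀ L : ℕ, Fact (0 < c₀ L)] [hcB : ∀ L : ℕ, Fact (0 < cB L)]

/-- ★★ **THE A6ᶜ CERTIFICATE, FAMILY FORM — `hN06`'s TEXT WITH THE MEMBER FIXED AT `W := 1`, `B₀` L-ONLY, `∀ K` INSIDE:** if the comb-penalty weights are positive (`0 < a₀ L`) and the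
slice bound (I3′) holds at every member `F` with `F.L = L`, `n < K`, with an L-only `ρ L ≥ 0`, then for every `L > 1`:
`∃ B₀ > 0, ∀ F (F.L = L) n K (n < K), ∃ G₀, Δ_aᶜ(1) ∘ₗ G₀ = id ∧ ∀ f, ‖G₀ f‖ ≤ B₀‖f‖` at the comb slots of record, `B₀ := 4·Cst 3 (a₀ L)·(2+2ρ L)`.  With `regPr_one_mem` this is the
displayed row `hN06` of S27ᴸ read at the member `1` (its `eN` arbitrary).  [cite: Balaban1985BackgroundPropagators, Thm 3.3 p.399, Thm 3.11 p.416, (3.27) p.395; Balaban1984PropagatorsI, Prop. 1.1 (1.90) p.33] -/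
theorem hN06_prefix_at_one_of_sliceRows (ha₀ : ∀ L : ℕ, 1 < L → 0 < a₀ L) (ρ : ℕ → ℝ) (hρ : ∀ L : ℕ, 1 < L → 0 ≤ ρ L)
    (hv : ∀ (L : ℕ), 1 < L → ∀ (F : T3Family), F.L = L → ∀ (n K : ℕ) (hnK : n < K) (X : PBond (F.P K) 0 → Matrix (Fin 2) (Fin 2) ℂ),
      (a₀ F.L * (c₀ F.L / cB F.L) * ((F.L : ℝ) ^ (K - n)) ^ 3)
          * ‖Qkc F n K hnK.le (c₀ F.L) (cB F.L) (1 : GaugeField (F.P K) 0 (Matrix.specialUnitaryGroup (Fin 2) ℂ))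
                (toL2 F K (c₀ F.L) (fun b => X (b.translate (-basePt F n K))))
              - Qk F n K hnK.le (c₀ F.L) (cB F.L) (1 : GaugeField (F.P K) 0 (Matrix.specialUnitaryGroup (Fin 2) ℂ)) (toL2 F K (c₀ F.L) X)‖ ^ 2
        ≤ ρ L * (RCLike.re ⟪toL2 F K (c₀ F.L) X, DeltaEtaSlot F n K (c₀ F.L) 1 (toL2 F K (c₀ F.L) X)⟫_ℂ
              + ‖RS F n K hnK.le (c₀ F.L) (cB F.L) (1 : GaugeField (F.P K) 0 (Matrix.specialUnitaryGroup (Fin 2) ℂ))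
                  (DstarL2 F n K (c₀ F.L) (1 : GaugeField (F.P K) 0 (Matrix.specialUnitaryGroup (Fin 2) ℂ)) (toL2 F K (c₀ F.L) X))‖ ^ 2)) :
    ∀ (L : ℕ), 1 < L → ∃ B₀ : ℝ, 0 < B₀ ∧
      ∀ (F : T3Family), F.L = L → ∀ (n K : ℕ) (hnK : n < K),
        ∃ G₀ : BondL2K ℂ 3 (periodsT3 F K) (c₀ F.L) W₂ →ₗ[ℂ] BondL2K ℂ 3 (periodsT3 F K) (c₀ F.L) W₂,
          laplaceAK (DeltaEtaSlot F n K (c₀ F.L) 1) (DL2 F n K (c₀ F.L) 1) (RcombL2 F n K (c₀ F.L) 1) (DstarL2 F n K (c₀ F.L) 1)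
              (Qkc F n K hnK.le (c₀ F.L) (cB F.L) 1) (LinearMap.adjoint (Qkc F n K hnK.le (c₀ F.L) (cB F.L) 1))
              (((a₀ F.L * (c₀ F.L / cB F.L) * ((F.L : ℝ) ^ (K - n)) ^ 3 : ℝ) : ℂ)) ∘ₗ G₀ = LinearMap.id ∧
          ∀ f, ‖G₀ f‖ ≤ B₀ * ‖f‖ := by
  intro L hL
  have hC : 0 < B5Prop11Plancherel.Cst 3 (a₀ L) := B5Prop11Lattice.Cst_pos (d := 3) (a := a₀ L)
  refine ⟨4 * B5Prop11Plancherel.Cst 3 (a₀ L) * (2 + 2 * ρ L), by have := hρ L hL; positivity, ?_⟩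
  intro F hF n K hnK
  have h := hN06_at_one_of_sliceRow (F := F) (c₀ := c₀ F.L) (cB := cB F.L) hnK (hF ▸ ha₀ L hL) (hF ▸ hρ L hL) (hv L hL F hF n K hnK)
  rw [hF] at h ⊢
  exact h

end Family

/-! ## §3 ★★★ The A6ᶜ certificate from a FILLING CERTIFICATE `(S, A, M)` of the translated defect alone -/

section Filling

variable {F : T3Family} {n K : ℕ} {c₀ cB : ℝ} [Fact (0 < c₀)] [Fact (0 < cB)]

/-- ★★★ **THE A6ᶜ CERTIFICATE FROM A FILLING CERTIFICATE ALONE** (w4 g8 FILE B §5 ✓`coercive_laplaceAc_one_of_filling`, read at the displayed slot and in the display's `∃ G₀` form): for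
`a₀ > 0` and every real plaquette family `S` with `toL2B⁻¹(Q_kᶜ(1)(toL2 (X ∘ translate(−x₀))) − Q_k(1)(toL2 X))(c) = Σ_p S_c(p) • curl 1 X p`, `Σ_p S_c(p)² ≤ A` (`0 ≤ A`) and
`#{c : S_c(p) ≠ 0} ≤ M`: `∃ G₀, laplaceAK (DeltaEtaSlot 1) (DL2 1) (RcombL2 1) (DstarL2 1) (Qkc 1) (Qkc 1)† ↑(a₀(c₀∕cB)ℓ³) ∘ₗ G₀ = id ∧ ∀ f, ‖G₀ f‖ ≤ 4·Cst 3 a₀·(2 + 2·(a₀·(A·M)·ℓ))·‖f‖` —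
K-uniform iff `A·M·ℓ` is L-only (LOCATE v2: `A·M·ℓ ≤ 3.2·10³`).  [cite: Balaban1985BackgroundPropagators, Thm 3.3 p.399, Thm 3.11 p.416, (3.27) p.395, (3.115) p.418; Balaban1984PropagatorsI, Prop. 1.1 (1.90) p.33] -/
theorem hN06_at_one_of_filling (hnK : n < K) {a₀ : ℝ} (ha₀ : 0 < a₀)
    (S : PBond (F.P n) 0 → Plaq (F.P K) 0 → ℝ)
    (hS : ∀ (X : PBond (F.P K) 0 → Matrix (Fin 2) (Fin 2) ℂ) (c : PBond (F.P n) 0),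
      (toL2B F n cB).symm
          (Qkc F n K hnK.le c₀ cB (1 : GaugeField (F.P K) 0 (Matrix.specialUnitaryGroup (Fin 2) ℂ)) (toL2 F K c₀ (fun b => X (b.translate (-basePt F n K))))
            - Qk F n K hnK.le c₀ cB (1 : GaugeField (F.P K) 0 (Matrix.specialUnitaryGroup (Fin 2) ℂ)) (toL2 F K c₀ X)) c
        = ∑ p : Plaq (F.P K) 0, (S c p : ℂ) • curl 1 X p)
    {A M : ℝ} (hA0 : 0 ≤ A) (hA : ∀ c, ∑ p, S c p ^ 2 ≤ A) (hM : ∀ p, ((Finset.univ.filter fun c => S c p ≠ 0).card : ℝ) ≤ M) :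
    ∃ G₀ : BondL2K ℂ 3 (periodsT3 F K) c₀ W₂ →ₗ[ℂ] BondL2K ℂ 3 (periodsT3 F K) c₀ W₂,
      laplaceAK (DeltaEtaSlot F n K c₀ 1) (DL2 F n K c₀ 1) (RcombL2 F n K c₀ 1) (DstarL2 F n K c₀ 1)
          (Qkc F n K hnK.le c₀ cB 1) (LinearMap.adjoint (Qkc F n K hnK.le c₀ cB 1))
          (((a₀ * (c₀ / cB) * ((F.L : ℝ) ^ (K - n)) ^ 3 : ℝ) : ℂ)) ∘ₗ G₀ = LinearMap.id ∧
      ∀ f, ‖G₀ f‖ ≤ 4 * B5Prop11Plancherel.Cst 3 a₀ * (2 + 2 * (a₀ * (A * M) * (F.L : ℝ) ^ (K - n))) * ‖f‖ := by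
  have hC : 0 < B5Prop11Plancherel.Cst 3 a₀ := B5Prop11Lattice.Cst_pos (d := 3) (a := a₀)
  -- w4's end-to-end knit at the intrinsic letter `laplaceAc … (DeltaEtaSlot) 1`, transported to the displayed slot
  have hco : ∀ y : BondL2K ℂ 3 (periodsT3 F K) c₀ W₂,
      (1 / (4 * B5Prop11Plancherel.Cst 3 a₀ * (2 + 2 * (a₀ * (A * M) * (F.L : ℝ) ^ (K - n))))) * ‖y‖ ^ 2
        ≤ RCLike.re ⟪y, laplaceAK (DeltaEtaSlot F n K c₀ 1) (DL2 F n K c₀ 1) (RcombL2 F n K c₀ 1) (DstarL2 F n K c₀ 1)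
            (Qkc F n K hnK.le c₀ cB 1) (LinearMap.adjoint (Qkc F n K hnK.le c₀ cB 1))
            (((a₀ * (c₀ / cB) * ((F.L : ℝ) ^ (K - n)) ^ 3 : ℝ) : ℂ)) y⟫_ℂ := by
    intro y
    rw [RcombL2_one_eq_Rc_one (F := F) (n := n) (K := K) (c₀ := c₀) (cB := cB) hnK.le, ← laplaceAc_eq_laplaceAK]
    exact coercive_laplaceAc_one_of_filling (h := hnK.le) (cB := cB) ha₀ (DeltaEtaSlot F n K c₀) rfl S hS hA0 hA hM y
  -- the constant is positive: `M ≥ 0` from one plaquette witness (d = 3), as in w4's §5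
  have hM0 : 0 ≤ M := (Nat.cast_nonneg _).trans (hM ⟨default, ⟨0, by simp⟩, ⟨1, by simp⟩, Fin.mk_lt_mk.2 Nat.zero_lt_one⟩)
  have hL : (0 : ℝ) < F.L := by exact_mod_cast lt_trans zero_lt_one F.hL.2
  have hρ : 0 ≤ a₀ * (A * M) * (F.L : ℝ) ^ (K - n) := by have := ha₀.le; positivity
  have hγ : 0 < 1 / (4 * B5Prop11Plancherel.Cst 3 a₀ * (2 + 2 * (a₀ * (A * M) * (F.L : ℝ) ^ (K - n)))) := by positivity
  obtain ⟨G₀, hG, -, hB⟩ := exists_inverse_of_coercive _ hγ hco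
  refine ⟨G₀, hG, fun f => ?_⟩
  have h := hB f
  rwa [one_div, inv_inv] at h

end Filling

section FillingFamily

variable (c₀ cB a₀ : ℕ → ℝ) [hc₀ : ∀ L : ℕ, Fact (0 < c₀ L)] [hcB : ∀ L : ℕ, Fact (0 < cB L)]

/-- ★★ **THE A6ᶜ CERTIFICATE FROM FILLING CERTIFICATES, FAMILY FORM**: if every member `F (F.L = L)`, `n < K` carries a filling certificate `(S, A, M)` of its translated defect with
`A·M·L^{K−n} ≤ C L` for an L-only `C L ≥ 0` (w4 g8 LOCATE v2: `C = 3.2·10³` suffices), then for every `L > 1` there is an L-only `B₀ > 0` (`:= 4·Cst 3 (a₀ L)·(2 + 2·a₀ L·C L)`) with `hN06`'s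
conclusion at `W := 1` for ALL `F (F.L = L)`, `n < K`.  [cite: Balaban1985BackgroundPropagators, Thm 3.3 p.399, Thm 3.11 p.416, (3.27) p.395; Balaban1984PropagatorsI, Prop. 1.1 (1.90) p.33] -/
theorem hN06_prefix_at_one_of_fillings (ha₀ : ∀ L : ℕ, 1 < L → 0 < a₀ L) (C : ℕ → ℝ) (hC : ∀ L : ℕ, 1 < L → 0 ≤ C L)
    (hfill : ∀ (L : ℕ), 1 < L → ∀ (F : T3Family), F.L = L → ∀ (n K : ℕ) (hnK : n < K),
      ∃ (S : PBond (F.P n) 0 → Plaq (F.P K) 0 → ℝ) (A M : ℝ),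
        (∀ (X : PBond (F.P K) 0 → Matrix (Fin 2) (Fin 2) ℂ) (c : PBond (F.P n) 0),
          (toL2B F n (cB F.L)).symm
              (Qkc F n K hnK.le (c₀ F.L) (cB F.L) (1 : GaugeField (F.P K) 0 (Matrix.specialUnitaryGroup (Fin 2) ℂ))
                  (toL2 F K (c₀ F.L) (fun b => X (b.translate (-basePt F n K))))
                - Qk F n K hnK.le (c₀ F.L) (cB F.L) (1 : GaugeField (F.P K) 0 (Matrix.specialUnitaryGroup (Fin 2) ℂ)) (toL2 F K (c₀ F.L) X)) c
            = ∑ p : Plaq (F.P K) 0, (S c p : ℂ) • curl 1 X p) ∧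
        0 ≤ A ∧ (∀ c, ∑ p, S c p ^ 2 ≤ A) ∧ (∀ p, ((Finset.univ.filter fun c => S c p ≠ 0).card : ℝ) ≤ M) ∧
        A * M * (F.L : ℝ) ^ (K - n) ≤ C L) :
    ∀ (L : ℕ), 1 < L → ∃ B₀ : ℝ, 0 < B₀ ∧
      ∀ (F : T3Family), F.L = L → ∀ (n K : ℕ) (hnK : n < K),
        ∃ G₀ : BondL2K ℂ 3 (periodsT3 F K) (c₀ F.L) W₂ →ₗ[ℂ] BondL2K ℂ 3 (periodsT3 F K) (c₀ F.L) W₂,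
          laplaceAK (DeltaEtaSlot F n K (c₀ F.L) 1) (DL2 F n K (c₀ F.L) 1) (RcombL2 F n K (c₀ F.L) 1) (DstarL2 F n K (c₀ F.L) 1)
              (Qkc F n K hnK.le (c₀ F.L) (cB F.L) 1) (LinearMap.adjoint (Qkc F n K hnK.le (c₀ F.L) (cB F.L) 1))
              (((a₀ F.L * (c₀ F.L / cB F.L) * ((F.L : ℝ) ^ (K - n)) ^ 3 : ℝ) : ℂ)) ∘ₗ G₀ = LinearMap.id ∧
          ∀ f, ‖G₀ f‖ ≤ B₀ * ‖f‖ := by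
  intro L hL
  have hCst : 0 < B5Prop11Plancherel.Cst 3 (a₀ L) := B5Prop11Lattice.Cst_pos (d := 3) (a := a₀ L)
  have ha := ha₀ L hL
  have hCL := hC L hL
  refine ⟨4 * B5Prop11Plancherel.Cst 3 (a₀ L) * (2 + 2 * (a₀ L * C L)), by positivity, ?_⟩
  intro F hF n K hnK
  obtain ⟨S, A, M, hS, hA0, hA, hM, hAM⟩ := hfill L hL F hF n K hnK
  subst hF
  obtain ⟨G₀, hG, hB⟩ := hN06_at_one_of_filling (F := F) (c₀ := c₀ F.L) (cB := cB F.L) hnK ha S hS hA0 hA hM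
  refine ⟨G₀, hG, fun f => (hB f).trans ?_⟩
  have h1 : a₀ F.L * (A * M) * (F.L : ℝ) ^ (K - n) ≤ a₀ F.L * C F.L := by
    rw [mul_assoc]
    exact mul_le_mul_of_nonneg_left hAM ha.le
  have h3 : 4 * B5Prop11Plancherel.Cst 3 (a₀ F.L) * (2 + 2 * (a₀ F.L * (A * M) * (F.L : ℝ) ^ (K - n)))
      ≤ 4 * B5Prop11Plancherel.Cst 3 (a₀ F.L) * (2 + 2 * (a₀ F.L * C F.L)) := by nlinarith [hCst.le]
  exact mul_le_mul_of_nonneg_right h3 (norm_nonneg f)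

end FillingFamily

/-! ## §4 (v2.1, APPEND) ★★★ The A6ᶜ certificate from the DIRECT `ℓ²` SLICE BOUND `hT` (w4 g8 FILE B′ ✓`Prop7SliceRowOfSqBound` — the output of PLAN B's P4 «SliceBoundOneStep») -/

section SqBound

variable {F : T3Family} {n K : ℕ} {c₀ cB : ℝ} [Fact (0 < c₀)] [Fact (0 < cB)]

/-- ★★★ **THE A6ᶜ CERTIFICATE FROM THE `ℓ²` SLICE BOUND `hT` ALONE** (FILE B′ `coercive_laplaceAc_one_of_sqBound`, read at the displayed slot and in the display's `∃ G₀` form): if the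
translated comb∕tube defect obeys `Σ_c Σ_{ii′} ‖toL2B⁻¹(Q_kᶜ(1)(toL2 (X ∘ translate(−x₀))) − Q_k(1)(toL2 X)) c i i′‖² ≤ A′·Σ_p Σ_{ii′} ‖curl 1 X p i i′‖²` for every `X` (`0 ≤ A′`; PLAN B P1–P4: `A′ = C(L)∕ℓ`),
then `∃ G₀, laplaceAK (DeltaEtaSlot 1) (DL2 1) (RcombL2 1) (DstarL2 1) (Qkc 1) (Qkc 1)† ↑(a₀(c₀∕cB)ℓ³) ∘ₗ G₀ = id ∧ ∀ f, ‖G₀ f‖ ≤ 4·Cst 3 a₀·(2 + 2·(a₀·A′·ℓ))·‖f‖` — `hN06`'s conclusion at the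
member `1`; K-uniform iff `A′·ℓ` is L-only.  [cite: Balaban1985BackgroundPropagators, Thm 3.3 p.399, Thm 3.11 p.416, (3.27) p.395, (3.115) p.418; Balaban1984PropagatorsI, Prop. 1.1 (1.90) p.33] -/
theorem hN06_at_one_of_sqBound (hnK : n < K) {a₀ : ℝ} (ha₀ : 0 < a₀) {A' : ℝ} (hA' : 0 ≤ A')
    (hT : ∀ X : PBond (F.P K) 0 → Matrix (Fin 2) (Fin 2) ℂ,
      ∑ c : PBond (F.P n) 0, ∑ i, ∑ i',
        ‖(toL2B F n cB).symm
            (Qkc F n K hnK.le c₀ cB (1 : GaugeField (F.P K) 0 (Matrix.specialUnitaryGroup (Fin 2) ℂ)) (toL2 F K c₀ (fun b => X (b.translate (-basePt F n K))))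
              - Qk F n K hnK.le c₀ cB (1 : GaugeField (F.P K) 0 (Matrix.specialUnitaryGroup (Fin 2) ℂ)) (toL2 F K c₀ X)) c i i'‖ ^ 2
        ≤ A' * ∑ p : Plaq (F.P K) 0, ∑ i, ∑ i', ‖curl 1 X p i i'‖ ^ 2) :
    ∃ G₀ : BondL2K ℂ 3 (periodsT3 F K) c₀ W₂ →ₗ[ℂ] BondL2K ℂ 3 (periodsT3 F K) c₀ W₂,
      laplaceAK (DeltaEtaSlot F n K c₀ 1) (DL2 F n K c₀ 1) (RcombL2 F n K c₀ 1) (DstarL2 F n K c₀ 1)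
          (Qkc F n K hnK.le c₀ cB 1) (LinearMap.adjoint (Qkc F n K hnK.le c₀ cB 1))
          (((a₀ * (c₀ / cB) * ((F.L : ℝ) ^ (K - n)) ^ 3 : ℝ) : ℂ)) ∘ₗ G₀ = LinearMap.id ∧
      ∀ f, ‖G₀ f‖ ≤ 4 * B5Prop11Plancherel.Cst 3 a₀ * (2 + 2 * (a₀ * A' * (F.L : ℝ) ^ (K - n))) * ‖f‖ := by
  have hC : 0 < B5Prop11Plancherel.Cst 3 a₀ := B5Prop11Lattice.Cst_pos (d := 3) (a := a₀)
  have hco : ∀ y : BondL2K ℂ 3 (periodsT3 F K) c₀ W₂,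
      (1 / (4 * B5Prop11Plancherel.Cst 3 a₀ * (2 + 2 * (a₀ * A' * (F.L : ℝ) ^ (K - n))))) * ‖y‖ ^ 2
        ≤ RCLike.re ⟪y, laplaceAK (DeltaEtaSlot F n K c₀ 1) (DL2 F n K c₀ 1) (RcombL2 F n K c₀ 1) (DstarL2 F n K c₀ 1)
            (Qkc F n K hnK.le c₀ cB 1) (LinearMap.adjoint (Qkc F n K hnK.le c₀ cB 1))
            (((a₀ * (c₀ / cB) * ((F.L : ℝ) ^ (K - n)) ^ 3 : ℝ) : ℂ)) y⟫_ℂ := by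
    intro y
    rw [RcombL2_one_eq_Rc_one (F := F) (n := n) (K := K) (c₀ := c₀) (cB := cB) hnK.le, ← laplaceAc_eq_laplaceAK]
    exact coercive_laplaceAc_one_of_sqBound (h := hnK.le) (cB := cB) ha₀ (DeltaEtaSlot F n K c₀) rfl hA' hT y
  have hL : (0 : ℝ) < F.L := by exact_mod_cast lt_trans zero_lt_one F.hL.2
  have hρ : 0 ≤ a₀ * A' * (F.L : ℝ) ^ (K - n) := by have := ha₀.le; positivity
  have hγ : 0 < 1 / (4 * B5Prop11Plancherel.Cst 3 a₀ * (2 + 2 * (a₀ * A' * (F.L : ℝ) ^ (K - n)))) := by positivity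
  obtain ⟨G₀, hG, -, hB⟩ := exists_inverse_of_coercive _ hγ hco
  refine ⟨G₀, hG, fun f => ?_⟩
  have h := hB f
  rwa [one_div, inv_inv] at h

end SqBound

section SqBoundFamily

variable (c₀ cB a₀ : ℕ → ℝ) [hc₀ : ∀ L : ℕ, Fact (0 < c₀ L)] [hcB : ∀ L : ℕ, Fact (0 < cB L)]

/-- ★★ **THE A6ᶜ CERTIFICATE FROM `ℓ²` SLICE BOUNDS, FAMILY FORM**: if every member `F (F.L = L)`, `n < K` obeys the `ℓ²` slice bound with some `A′ ≥ 0`, `A′·L^{K−n} ≤ C L` for an L-only `C L ≥ 0`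
(PLAN B: `A′ = C(L)∕ℓ`), then for every `L > 1` there is an L-only `B₀ > 0` (`:= 4·Cst 3 (a₀ L)·(2 + 2·a₀ L·C L)`) with `hN06`'s conclusion at `W := 1` for ALL `F (F.L = L)`, `n < K` — `∀ K` inside.
[cite: Balaban1985BackgroundPropagators, Thm 3.3 p.399, Thm 3.11 p.416, (3.27) p.395; Balaban1984PropagatorsI, Prop. 1.1 (1.90) p.33] -/
theorem hN06_prefix_at_one_of_sqBounds (ha₀ : ∀ L : ℕ, 1 < L → 0 < a₀ L) (C : ℕ → ℝ) (hC : ∀ L : ℕ, 1 < L → 0 ≤ C L)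
    (hsq : ∀ (L : ℕ), 1 < L → ∀ (F : T3Family), F.L = L → ∀ (n K : ℕ) (hnK : n < K), ∃ A' : ℝ, 0 ≤ A' ∧
      (∀ X : PBond (F.P K) 0 → Matrix (Fin 2) (Fin 2) ℂ,
        ∑ c : PBond (F.P n) 0, ∑ i, ∑ i',
          ‖(toL2B F n (cB F.L)).symm
              (Qkc F n K hnK.le (c₀ F.L) (cB F.L) (1 : GaugeField (F.P K) 0 (Matrix.specialUnitaryGroup (Fin 2) ℂ))
                  (toL2 F K (c₀ F.L) (fun b => X (b.translate (-basePt F n K))))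
                - Qk F n K hnK.le (c₀ F.L) (cB F.L) (1 : GaugeField (F.P K) 0 (Matrix.specialUnitaryGroup (Fin 2) ℂ)) (toL2 F K (c₀ F.L) X)) c i i'‖ ^ 2
          ≤ A' * ∑ p : Plaq (F.P K) 0, ∑ i, ∑ i', ‖curl 1 X p i i'‖ ^ 2) ∧
      A' * (F.L : ℝ) ^ (K - n) ≤ C L) :
    ∀ (L : ℕ), 1 < L → ∃ B₀ : ℝ, 0 < B₀ ∧
      ∀ (F : T3Family), F.L = L → ∀ (n K : ℕ) (hnK : n < K),
        ∃ G₀ : BondL2K ℂ 3 (periodsT3 F K) (c₀ F.L) W₂ →ₗ[ℂ] BondL2K ℂ 3 (periodsT3 F K) (c₀ F.L) W₂,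
          laplaceAK (DeltaEtaSlot F n K (c₀ F.L) 1) (DL2 F n K (c₀ F.L) 1) (RcombL2 F n K (c₀ F.L) 1) (DstarL2 F n K (c₀ F.L) 1)
              (Qkc F n K hnK.le (c₀ F.L) (cB F.L) 1) (LinearMap.adjoint (Qkc F n K hnK.le (c₀ F.L) (cB F.L) 1))
              (((a₀ F.L * (c₀ F.L / cB F.L) * ((F.L : ℝ) ^ (K - n)) ^ 3 : ℝ) : ℂ)) ∘ₗ G₀ = LinearMap.id ∧
          ∀ f, ‖G₀ f‖ ≤ B₀ * ‖f‖ := by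
  intro L hL
  have hCst : 0 < B5Prop11Plancherel.Cst 3 (a₀ L) := B5Prop11Lattice.Cst_pos (d := 3) (a := a₀ L)
  have ha := ha₀ L hL
  have hCL := hC L hL
  refine ⟨4 * B5Prop11Plancherel.Cst 3 (a₀ L) * (2 + 2 * (a₀ L * C L)), by positivity, ?_⟩
  intro F hF n K hnK
  obtain ⟨A', hA', hT, hAC⟩ := hsq L hL F hF n K hnK
  subst hF
  obtain ⟨G₀, hG, hB⟩ := hN06_at_one_of_sqBound (F := F) (c₀ := c₀ F.L) (cB := cB F.L) hnK ha hA' hT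
  refine ⟨G₀, hG, fun f => (hB f).trans ?_⟩
  have h1 : a₀ F.L * A' * (F.L : ℝ) ^ (K - n) ≤ a₀ F.L * C F.L := by
    rw [mul_assoc]
    exact mul_le_mul_of_nonneg_left hAC ha.le
  have h3 : 4 * B5Prop11Plancherel.Cst 3 (a₀ F.L) * (2 + 2 * (a₀ F.L * A' * (F.L : ℝ) ^ (K - n)))
      ≤ 4 * B5Prop11Plancherel.Cst 3 (a₀ F.L) * (2 + 2 * (a₀ F.L * C F.L)) := by nlinarith [hCst.le]
  exact mul_le_mul_of_nonneg_right h3 (norm_nonneg f)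

end SqBoundFamily

end Summit.QuantumFields.YangMills.Theorems.Prop7A6cCertificateOfSliceRow

end
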